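import Mathlib.Analysis.Complex.ExponentialBounds
import Summits.KontsevichZagierPeriods.Zeta5Search.RecurrenceCertificateRates
import Summits.KontsevichZagierPeriods.Zeta5Search.CalibrationAperyRecurrence
import HarnessLib

/-!
# ζ(5) search — calibration: EXACT Apéry asymptotics and the Apéry exponent `13.417…` for `ζ(3)` (cell `pub-zeta5`, TYPER)

HONEST FRAMING: systematic search; no irrationality claim unless certified.

The Poincaré upgrade `RecurrenceCertificateRates.lean` instantiated on the calibration certificate
`aperyRecurrenceCertificate : RecurrenceCertificate (zetaValue 3)` (`CalibrationAperyRecurrence.lean`: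
Apéry's numbers `bₙ = q_{n,n}`, `aₙ = p_{n,n}`, recurrence `y_{n+2} = sₙ y_{n+1} - tₙ yₙ`, box
`[33, 34]` from `N = 62`, denominators `lcm(1..n)³`). PROVED here (0 sorry):

* `tendsto_sApery`, `tendsto_tApery` — `sₙ → 34`, `tₙ → 1` (limiting equation `x² = 34x - 1`);
* `aperyLimitData` — the Poincaré data with `λ∞ = 17 + 12√2 = (1+√2)⁴` (`33 ≤ λ∞`, `|1| < 33²`);
* `tendsto_ratio_qT` — `b_{n+1}/bₙ → (1+√2)⁴`; `tendsto_log_qT_div` — `log bₙ / n → 4 log(1+√2)`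
  in the form `log (17+12√2) = 3.52549…`; `tendsto_root_qT`; the numerators `aₙ` likewise
  (`tendsto_log_abs_pT_div`): the classical Apéry asymptotics, as exact limits;
* `not_liouvilleWith_zetaThree` — **the Apéry exponent**: `¬ LiouvilleWith p (ζ(3))` for every
  `p > 1 + (log(17+12√2) + 3)/(log(17+12√2) - 3) = 13.41782…`, i.e. `μ(ζ(3)) ≤ 13.417…` (Apéry 1979),
  PROVED from the tree's Apéry table + prime number theorem + Poincaré; and the rounded instance
  `not_liouvilleWith_fourteen : ¬ LiouvilleWith 14 (zetaValue 3)` (via `log(17+12√2) > 7/2`).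
  The record `μ(ζ(3)) < 5.513891` (Rhin–Viola 2001) is a cited fact in the tree
  (`Literature.…RhinViola2001`); the present weaker bound is the first PROVED measure for `ζ(3)` here.
-/

noncomputable section

open Filter Topology Finset
open Literature.NumberTheory.Transcendental
open Literature.NumberTheory.Transcendental.Apery

namespace Summit.KontsevichZagierPeriods.Zeta5Search

namespace CalibrationAperyRecurrence

/-! ### Limits of the coefficients -/

/-- `1/(n+1) → 0` along `ℕ`. -/
private theorem tendsto_inv_succ : Tendsto (fun m : ℕ => (1 : ℝ) / ((m : ℝ) + 1)) atTop (𝓝 0) :=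
  tendsto_one_div_add_atTop_nhds_zero_nat

/-- **`sₙ → 34`** (`sₙ = (34(n+1)³ + 51(n+1)² + 27(n+1) + 5)/(n+2)³`). -/
theorem tendsto_sApery : Tendsto (fun n : ℕ => (sApery n : ℝ)) atTop (𝓝 34) := by
  set F : ℝ → ℝ := fun y => 34 + 51 * y + 27 * y ^ 2 + 5 * y ^ 3 with hF
  set G : ℝ → ℝ := fun y => (1 + y) ^ 3 with hG
  have hGpos : ∀ m : ℕ, 0 < G (1 / ((m : ℝ) + 1)) := by intro m; rw [hG]; positivity
  have hseq : ∀ m : ℕ, (sApery m : ℝ) = F (1 / ((m : ℝ) + 1)) / G (1 / ((m : ℝ) + 1)) := by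
    intro m
    have hm : (m : ℝ) + 1 ≠ 0 := by positivity
    have hm2 : (m : ℝ) + 2 ≠ 0 := by positivity
    rw [eq_div_iff (hGpos m).ne']
    unfold sApery
    push_cast
    rw [hF, hG]
    simp only
    field_simp
    ring
  have hFc : Continuous F := by rw [hF]; fun_prop
  have hGc : Continuous G := by rw [hG]; fun_prop
  have hF0 : Tendsto (fun m : ℕ => F (1 / ((m : ℝ) + 1))) atTop (𝓝 (F 0)) :=
    (hFc.tendsto 0).comp tendsto_inv_succ
  have hG0 : Tendsto (fun m : ℕ => G (1 / ((m : ℝ) + 1))) atTop (𝓝 (G 0)) :=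
    (hGc.tendsto 0).comp tendsto_inv_succ
  have hG0ne : G 0 ≠ 0 := by rw [hG]; norm_num
  have hlim : F 0 / G 0 = 34 := by rw [hF, hG]; norm_num
  rw [← hlim]
  exact (hF0.div hG0 hG0ne).congr fun m => (hseq m).symm

/-- **`tₙ → 1`** (`tₙ = (n+1)³/(n+2)³`). -/
theorem tendsto_tApery : Tendsto (fun n : ℕ => (tApery n : ℝ)) atTop (𝓝 1) := by
  set G : ℝ → ℝ := fun y => (1 + y) ^ 3 with hG
  have hGpos : ∀ m : ℕ, 0 < G (1 / ((m : ℝ) + 1)) := by intro m; rw [hG]; positivity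
  have hteq : ∀ m : ℕ, (tApery m : ℝ) = 1 / G (1 / ((m : ℝ) + 1)) := by
    intro m
    have hm : (m : ℝ) + 1 ≠ 0 := by positivity
    have hm2 : (m : ℝ) + 2 ≠ 0 := by positivity
    rw [eq_div_iff (hGpos m).ne']
    unfold tApery
    push_cast
    rw [hG]
    simp only
    field_simp
    ring
  have hGc : Continuous G := by rw [hG]; fun_prop
  have hG0 : Tendsto (fun m : ℕ => G (1 / ((m : ℝ) + 1))) atTop (𝓝 (G 0)) :=
    (hGc.tendsto 0).comp tendsto_inv_succ
  have hG0ne : G 0 ≠ 0 := by rw [hG]; norm_num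
  have hlim : 1 / G 0 = 1 := by rw [hG]; norm_num
  rw [← hlim]
  exact (tendsto_const_nhds.div hG0 hG0ne).congr fun m => (hteq m).symm

/-! ### The dominant root `17 + 12√2 = (1+√2)⁴` -/

/-- `(1+√2)⁴ = 17 + 12√2`. -/
theorem one_add_sqrt_two_pow_four : (1 + Real.sqrt 2) ^ 4 = 17 + 12 * Real.sqrt 2 := by
  have hs : Real.sqrt 2 ^ 2 = 2 := Real.sq_sqrt (by norm_num)
  linear_combination (Real.sqrt 2 ^ 2 + 4 * Real.sqrt 2 + 8) * hs

/-- **The Poincaré data of the Apéry certificate**: `sₙ → 34`, `tₙ → 1`, `λ∞ = 17 + 12√2`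
(`λ∞² = 34λ∞ - 1`, `33 ≤ λ∞`, `|1| < 33²`). -/
def aperyLimitData : aperyRecurrenceCertificate.LimitData where
  a := 34
  b := 1
  lam := 17 + 12 * Real.sqrt 2
  tendsto_s := tendsto_sApery
  tendsto_t := tendsto_tApery
  charEq := by
    have hs : Real.sqrt 2 ^ 2 = 2 := Real.sq_sqrt (by norm_num)
    linear_combination 144 * hs
  lam_le := by
    -- `4/3 < √2`, so `33 < 17 + 12√2 = 33.97…` (inlined: the bare inequality is already a lemma
    -- elsewhere in the tree, `LSTWord.four_thirds_lt_sqrt_two`, in an unrelated Computability module)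
    have h : (4 / 3 : ℝ) < Real.sqrt 2 := by
      rw [show (4 / 3 : ℝ) = Real.sqrt (16 / 9) by
        rw [show (16 / 9 : ℝ) = (4 / 3) ^ 2 by norm_num, Real.sqrt_sq (by norm_num)]]
      exact Real.sqrt_lt_sqrt (by norm_num) (by norm_num)
    have e : ((aperyRecurrenceCertificate.lam : ℚ) : ℝ) = 33 := by
      norm_num [aperyRecurrenceCertificate]
    rw [e]; linarith
  contr := by
    have e : ((aperyRecurrenceCertificate.lam : ℚ) : ℝ) = 33 := by
      norm_num [aperyRecurrenceCertificate]
    rw [e]; norm_num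

/-- The denominator exponent of the Apéry certificate is `δ₀ = 3` (`Dₙ = lcm(1..n)³`). -/
theorem denomRate₀_apery : aperyRecurrenceCertificate.denomRate₀ = 3 := by
  unfold RecurrenceCertificate.denomRate₀
  simp [aperyRecurrenceCertificate]

/-! ### Exact Apéry asymptotics -/

/-- **`b_{n+1}/bₙ → (1+√2)⁴`** for Apéry's numbers `bₙ = q_{n,n}`. -/
theorem tendsto_ratio_qT :
    Tendsto (fun n : ℕ => (qT (n + 1) (n + 1) : ℝ) / qT n n) atTop (𝓝 ((1 + Real.sqrt 2) ^ 4)) := by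
  rw [one_add_sqrt_two_pow_four]
  exact aperyLimitData.tendsto_ratio

/-- **`log bₙ / n → log (17+12√2) = 4 log(1+√2) = 3.52549…`**. -/
theorem tendsto_log_qT_div :
    Tendsto (fun n : ℕ => Real.log (qT n n : ℝ) / n) atTop (𝓝 (Real.log (17 + 12 * Real.sqrt 2))) :=
  aperyLimitData.tendsto_log_u_div

/-- `bₙ^{1/n} → 17 + 12√2`. -/
theorem tendsto_root_qT :
    Tendsto (fun n : ℕ => (qT n n : ℝ) ^ (1 / (n : ℝ))) atTop (𝓝 (17 + 12 * Real.sqrt 2)) :=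
  aperyLimitData.tendsto_root_u

/-- The numerators `aₙ = p_{n,n}` have the same rate: `log|aₙ|/n → log (17+12√2)`. -/
theorem tendsto_log_abs_pT_div :
    Tendsto (fun n : ℕ => Real.log |(pT n n : ℝ)| / n) atTop (𝓝 (Real.log (17 + 12 * Real.sqrt 2))) :=
  aperyLimitData.tendsto_log_abs_v_div

/-! ### The Apéry exponent -/

/-- **Apéry's irrationality exponent for `ζ(3)` (PROVED)**: `¬ LiouvilleWith p (ζ(3))` for every
`p > 1 + (log(17+12√2) + 3)/(log(17+12√2) - 3) = 13.41782…`. -/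
theorem not_liouvilleWith_zetaThree {p : ℝ}
    (hp : 1 + (Real.log (17 + 12 * Real.sqrt 2) + 3) / (Real.log (17 + 12 * Real.sqrt 2) - 3) < p) :
    ¬ LiouvilleWith p (zetaValue 3) := by
  have h := aperyLimitData.not_liouvilleWith_sharp (by norm_num [aperyLimitData]) (expo := p)
  rw [denomRate₀_apery] at h
  refine h ?_
  simpa [aperyLimitData] using hp

/-- `log (17 + 12√2) > 7/2` (`e^{7/2} = 33.115… < 33.970… = 17 + 12√2`; from `e < 2.7182818286`). -/
theorem seven_halves_lt_log : (7 / 2 : ℝ) < Real.log (17 + 12 * Real.sqrt 2) := by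
  have hpos : (0 : ℝ) < 17 + 12 * Real.sqrt 2 := by positivity
  rw [Real.lt_log_iff_exp_lt hpos]
  -- `exp (1/2) < 1.6488` since `exp (1/2)² = e < 2.7182818286 < 1.6488²`
  have hsq : Real.exp (1 / 2) ^ 2 = Real.exp 1 := by
    rw [← Real.exp_nat_mul]; norm_num
  have hhalf : Real.exp (1 / 2) < 16488 / 10000 := by
    have h1 : Real.exp (1 / 2) ^ 2 < (16488 / 10000 : ℝ) ^ 2 := by
      rw [hsq]; exact lt_trans Real.exp_one_lt_d9 (by norm_num)
    exact lt_of_pow_lt_pow_left₀ 2 (by norm_num) h1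
  have h7 : Real.exp (7 / 2) = Real.exp (1 / 2) ^ 7 := by
    rw [← Real.exp_nat_mul]; norm_num
  have hpow : Real.exp (1 / 2) ^ 7 < (16488 / 10000 : ℝ) ^ 7 :=
    pow_lt_pow_left₀ hhalf (Real.exp_pos _).le (by norm_num)
  -- `√2 > 1.414`, so `17 + 12√2 > 33.968 > 1.6488⁷ = 33.126…`
  have hs : (1414 / 1000 : ℝ) < Real.sqrt 2 := by
    rw [show (1414 / 1000 : ℝ) = Real.sqrt ((1414 / 1000) ^ 2) by rw [Real.sqrt_sq (by norm_num)]]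
    exact Real.sqrt_lt_sqrt (by norm_num) (by norm_num)
  rw [h7]
  have hnum : (16488 / 10000 : ℝ) ^ 7 < 17 + 12 * (1414 / 1000) := by norm_num
  linarith

/-- **`μ(ζ(3)) < 14`, PROVED**: `ζ(3)` is not `14`-Liouville (rounding of the Apéry exponent
`13.417…`; uses only `log(17+12√2) > 7/2`). -/
theorem not_liouvilleWith_fourteen : ¬ LiouvilleWith 14 (zetaValue 3) := by
  refine not_liouvilleWith_zetaThree ?_
  have hL := seven_halves_lt_log
  set L := Real.log (17 + 12 * Real.sqrt 2) with hLdef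
  have h3 : 0 < L - 3 := by linarith
  have hfrac : (L + 3) / (L - 3) < 13 := by
    rw [div_lt_iff₀ h3]; linarith
  linarith

end CalibrationAperyRecurrence

end Summit.KontsevichZagierPeriods.Zeta5Search
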